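import Summits.HodgeConjecture.HodgeConjecture.Theorems.H413E2SWBorelBoundLettersCongr
import Literature.NumberTheory.Weil1964.AdelicDoublingDiagonalLift
import Literature.NumberTheory.QuadraticForms.HasseMinkowskiDiagonal
import Literature.NumberTheory.Automorphic.UnitaryDualPairDoubledDiagonalThetaInvariance
import HarnessLib

/-!
# H413 · E-2 · SW2 (iii) — row SW2c-BOUND: the (IMPL)+(DOM-C) input `(s, hs, hproj, hdom)` of A6a ∕ A4 at the CM datum, for an
# ARBITRARY symmetric Gram matrix `T_V` (diagonalisation + `F`-rational congruence transport)

Cell `hodgecm-mathlib`, floor 0, programme P4, engine E-2, crux H413 (`stmt-HodgeConjecture-24833`, `--supports`); child line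
`Cruxes/H413/Lines/F0_E2SiegelWeilWeilRange.lean`, open stub `stub_SW2iii_siegelWeil`; row «A6 INPUT ADAPTER ∕ hdom_CM» of F0P4-plan (g4)
2026-08-31T05:20:53Z ∕ 06:01:25Z; seat F0P4-p05 (g3).  PROOF lane: theorems only, no definition, no notation, no `sorry`.  HC_CM is proved only
modulo the printed citations until rung 0 closes; nothing here is about Hodge classes.

WHAT THIS FILE DOES.  ★ A6a `E2SWBorelBoundFrameHom.exists_borelBound_frame_of_hom` ∕ `implementers_of_hom` (F0P4-p07 (g3)) turn A4's letter
`hIMPL` into four binders: a continuous homomorphism `s : U_D(𝔸_F) →* Mp_ψ(𝕎□_𝔸, 𝕋)ᶜᵒⁿᵗ` (`hs`), `U_D = U(T_W ⊕ −T_W)`,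
`𝕋 = doubledGramFin (adelicGram e T_V T_W)`, lying over `ι(1 ⊗ ·)` as automorphisms of `𝕎□_𝔸` (`hproj`), whose conjugates `ω(ũ · s(k) · ũ⁻¹)Φ`,
`ũ = u₀ · r_F(δ)`, are dominated on every compact `C ⊆ U_D(𝔸_F)` by ONE `Φ₀ ∈ 𝒮(𝔸_F^{n+n})` (`hdom`).  **`exists_implementerHom_CM`** supplies
all four at the generality of ★ `hfib_CM_of` and of the `hFIB` binder of ★ `siegelWeil_weilRange_CM_of_fib`: `F` totally real, `E/F` totally
complex quadratic, ANY symmetric invertible `T_V ∈ GL_N(F)`, `T_W = (t)`.  Proof: every symmetric `T_V` is `F`-rationally congruent to an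
invertible diagonal matrix (★ `QuadraticForms.exists_congr_diagonal`, [Serre1973, IV §1.4]): `T_V = Qᵀ diag(c) Q`; the doubled line IS
`1ᵀ diag(t, −t) 1` (`one_transpose_mul_diagonal_mul_one_eq_doubledLine`) and needs no sign hypothesis at any real place (`hrk_doubledLine`,
`j₀ := 1`); `adelicGram e□ T_V (T_W ⊕ −T_W) = 𝕋` (★ `adelicGram_doubled_eq_doubledGramFin`); so the sibling's `exists_implementerHom_of_congr`
(B-p12's Lemme 5 at the diagonal data, transported along the GR lane's ★ `congrMp` ∕ `toSp_congr`) applies with all three identities entered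
as equations — no cast in any statement.

References: A. Weil, *Sur certains groupes d'opérateurs unitaires*, Acta Math. 111 (1964), Chap. I n° 13 p. 160, Chap. III n° 41
Lemme 5 p. 194 [Weil1964]; A. Weil, *Sur la formule de Siegel dans la théorie des groupes classiques*, Acta Math. 113 (1965), n° 47
Lemme 20, n° 50 [Weil1965]; S. Gelbart, J. Rogawski, Invent. Math. 105 (1991), §3.1 p. 454 L21–42, Prop. 3.1.1 p. 455 [GelbartRogawski1991];
C. Mœglin, M.-F. Vignéras, J.-L. Waldspurger, LNM 1291 (1987), Chap. 2 II.1 (A)–(B) [MoeglinVignerasWaldspurger1987]; J.-P. Serre,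
*A Course in Arithmetic*, GTM 7 (1973), Ch. IV §1.4 [Serre1973].
-/

set_option autoImplicit false
-- the cell's `Summit.HodgeConjecture.HodgeConjecture.…` namespace repeats the summit name by design (D-0017 layout)
set_option linter.dupNamespace false

noncomputable section

open scoped NNReal ENNReal Matrix Kronecker
open _root_.MeasureTheory NumberField NumberField.InfinitePlace IsDedekindDomain Matrix
open Literature.RepresentationTheory.HeisenbergGroup
open Literature.NumberTheory.Weil1964 Literature.NumberTheory.Automorphic
open Literature.NumberTheory.Automorphic.UnitaryGroup
open Literature.NumberTheory.GelbartRogawski1991 Literature.NumberTheory.GelbartRogawski1991.UnitaryDualPair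
open Summit.HodgeConjecture.HodgeConjecture.Cruxes.H413.E2SWBorelBoundLettersCongr

namespace Summit.HodgeConjecture.HodgeConjecture.Cruxes.H413.E2SWBorelBoundLettersCM

/-! ## §3 The (IMPL)+(DOM-C) input of A4 ∕ A6a at the CM datum, ARBITRARY symmetric `T_V` -/

section CM

variable (F E : Type) [Field F] [NumberField F] [Field E] [NumberField E] [Algebra F E] [Algebra.IsQuadraticExtension F E]
  (c : E ≃ₐ[F] E) {δ : E} (hcδ : c δ = -δ) (hδ : δ ≠ 0) {d : F} (hd : δ * δ = algebraMap F E d)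
  (N : ℕ) {n : ℕ} (e : Fin N × Fin 1 ≃ Fin n)
  (TV : Matrix (Fin N) (Fin N) F) (TW : Matrix (Fin 1) (Fin 1) F) (hV : TV.IsSymm)
  (hW2 : (Matrix.reindex finSumFinEquiv finSumFinEquiv (Matrix.fromBlocks TW 0 0 (-TW))).IsSymm)
  (hVd : IsUnit TV.det) (hWd : IsUnit TW.det)

omit [NumberField F] in
/-- `1ᵀ · diag(t, −t) · 1 = T_W ⊕ −T_W` renumbered by `Fin (1 + 1)` (`T_W = (t)` a `1 × 1` matrix). [folklore] -/
theorem one_transpose_mul_diagonal_mul_one_eq_doubledLine :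
    (1 : Matrix (Fin (1 + 1)) (Fin (1 + 1)) F)ᵀ * Matrix.diagonal ![TW 0 0, -TW 0 0] * (1 : Matrix (Fin (1 + 1)) (Fin (1 + 1)) F) =
      Matrix.reindex finSumFinEquiv finSumFinEquiv (Matrix.fromBlocks TW 0 0 (-TW)) := by
  rw [Matrix.transpose_one, Matrix.one_mul, Matrix.mul_one]
  ext i j
  rw [Matrix.reindex_apply, Matrix.submatrix_apply]
  obtain ⟨i', rfl⟩ := (finSumFinEquiv : Fin 1 ⊕ Fin 1 ≃ Fin (1 + 1)).surjective i
  obtain ⟨j', rfl⟩ := (finSumFinEquiv : Fin 1 ⊕ Fin 1 ≃ Fin (1 + 1)).surjective j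
  rw [Equiv.symm_apply_apply, Equiv.symm_apply_apply]
  rcases i' with i' | i' <;> rcases j' with j' | j' <;>
    · have hi : i' = 0 := Subsingleton.elim _ _
      have hj : j' = 0 := Subsingleton.elim _ _
      subst hi hj
      simp [Matrix.diagonal, Matrix.fromBlocks, finSumFinEquiv]

omit [NumberField F] in
include hWd in
/-- `T_W 0 0 ≠ 0` (`T_W` invertible `1 × 1`). [folklore] -/
theorem tW_ne_zero : TW 0 0 ≠ 0 := fun h => hWd.ne_zero (by rw [Matrix.det_fin_one]; exact h)

omit [NumberField F] in
include hWd in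
/-- at every real place the signs of `(σ_v t, −σ_v t)` are one of each: `M = 2` needs no sign hypothesis (B-p12's `hrk` with `j₀ := 1`). [folklore] -/
theorem hrk_doubledLine (v : {v : InfinitePlace F // v.IsReal}) : ∃ j₀ : Fin (1 + 1),
    (∀ j, j ≠ j₀ → 0 < embedding_of_isReal v.2 (![TW 0 0, -TW 0 0] j)) ∨
      ∀ j, j ≠ j₀ → embedding_of_isReal v.2 (![TW 0 0, -TW 0 0] j) < 0 := by
  refine ⟨1, ?_⟩
  have h0 : embedding_of_isReal v.2 (TW 0 0) ≠ 0 := (map_ne_zero _).2 (tW_ne_zero F TW hWd)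
  have hj : ∀ j : Fin (1 + 1), j ≠ 1 → j = 0 := fun j hj => by
    fin_cases j
    · rfl
    · exact absurd rfl hj
  rcases lt_or_gt_of_ne h0 with h | h
  · right
    intro j hj1
    rw [hj j hj1]
    exact h
  · left
    intro j hj1
    rw [hj j hj1]
    exact h

include hV hVd hWd in
/-- **THE (IMPL)+(DOM-C) INPUT OF A4 ∕ A6a AT THE CM DATUM, FOR AN ARBITRARY SYMMETRIC `T_V`.**  For `F` totally real, `E/F` totally complex
quadratic, any symmetric invertible `T_V ∈ GL_N(F)` and `T_W = (t)`, `t ≠ 0`: a continuous homomorphism `s : U_D(𝔸_F) →* Mp_ψ(𝕎□_𝔸, 𝕋)ᶜᵒⁿᵗ`,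
`U_D = U(T_W ⊕ −T_W)`, `𝕋 = doubledGramFin (adelicGram e T_V T_W)`, lying over `ι(1 ⊗ ·)` as automorphisms of `𝕎□_𝔸`, whose conjugates
`ω(ũ · s(k) · ũ⁻¹)Φ`, `ũ = u₀ · r_F(δ)`, are dominated on every compact `C ⊆ U_D(𝔸_F)` by ONE `Φ₀ ∈ 𝒮(𝔸_F^{n+n})` — i.e. the binders
`(s) (hs) (hproj) (hdom)` of ★ `E2SWBorelBoundFrameHom.exists_borelBound_frame_of_hom` ∕ `implementers_of_hom` (F0P4-p07 (g3)), hence A4's `hIMPL`.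
Diagonalise `T_V = Qᵀ diag(c) Q` over `F` (★ `QuadraticForms.exists_congr_diagonal`, [Serre1973, IV §1.4]), note `T_W ⊕ −T_W = 1ᵀ diag(t,−t) 1`
and `adelicGram e□ T_V (T_W ⊕ −T_W) = 𝕋` (★ `adelicGram_doubled_eq_doubledGramFin`), and apply `exists_implementerHom_of_congr` (the compatible
splitting at the diagonal data transported along the rational congruence, with B-p12's Lemme 5).
[cite: Weil1964, Chap. III n° 41, Lemme 5 p. 194] [cite: Weil1965, Chap. V n° 47 Lemme 20, n° 50]
[cite: GelbartRogawski1991, §3.1 p. 454 L21–42, Prop. 3.1.1 p. 455 L1–3] [cite: MoeglinVignerasWaldspurger1987, Chap. 2 II.1 (A)–(B)]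
[cite: Serre1973, Ch. IV §1.4] -/
theorem exists_implementerHom_CM [IsTotallyReal F] [IsTotallyComplex E]
    (u₀ : adelicMpCont F (Fin (n + n)) (doubledGramFin F (adelicGram F e TV TW))) :
    ∃ s : ↥(UnitaryGroup.adelic F E c (1 + 1)
        ((Matrix.reindex finSumFinEquiv finSumFinEquiv (Matrix.fromBlocks TW 0 0 (-TW))).map (algebraMap F E))) →*
      adelicMpCont F (Fin (n + n)) (doubledGramFin F (adelicGram F e TV TW)),
      (Continuous fun A => (s A : adelicMp F (Fin (n + n)) (doubledGramFin F (adelicGram F e TV TW)))) ∧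
      (∀ (A : ↥(UnitaryGroup.adelic F E c (1 + 1)
          ((Matrix.reindex finSumFinEquiv finSumFinEquiv (Matrix.fromBlocks TW 0 0 (-TW))).map (algebraMap F E))))
          (v : (Fin (n + n) → AdeleRing (𝓞 F) F) × (Fin (n + n) → AdeleRing (𝓞 F) F)),
        ((adelicMpCont.proj F (Fin (n + n)) (doubledGramFin F (adelicGram F e TV TW)) (s A) :
            symplecticGroup (polar (adelicForm F (Fin (n + n)) (doubledGramFin F (adelicGram F e TV TW))))) :
          ((Fin (n + n) → AdeleRing (𝓞 F) F) × (Fin (n + n) → AdeleRing (𝓞 F) F)) ≃ₗ[AdeleRing (𝓞 F) F]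
            ((Fin (n + n) → AdeleRing (𝓞 F) F) × (Fin (n + n) → AdeleRing (𝓞 F) F))) v =
        ((toSp F E c N (1 + 1)
            (((Equiv.prodCongr (Equiv.refl (Fin N)) finSumFinEquiv.symm).trans (Equiv.prodSumDistrib (Fin N) (Fin 1) (Fin 1))).trans
              ((Equiv.sumCongr e e).trans finSumFinEquiv))
            (TV.map (algebraMap F E)) ((Matrix.reindex finSumFinEquiv finSumFinEquiv (Matrix.fromBlocks TW 0 0 (-TW))).map (algebraMap F E))
            hcδ hδ hd hV hW2 rfl rfl
            (adelicInr F E c N (1 + 1) (TV.map (algebraMap F E))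
              ((Matrix.reindex finSumFinEquiv finSumFinEquiv (Matrix.fromBlocks TW 0 0 (-TW))).map (algebraMap F E)) A) :
            symplecticGroup (polar (adelicForm F (Fin (n + n))
              (adelicGram F
                (((Equiv.prodCongr (Equiv.refl (Fin N)) finSumFinEquiv.symm).trans (Equiv.prodSumDistrib (Fin N) (Fin 1) (Fin 1))).trans
                  ((Equiv.sumCongr e e).trans finSumFinEquiv)) TV
                (Matrix.reindex finSumFinEquiv finSumFinEquiv (Matrix.fromBlocks TW 0 0 (-TW))))))) :
          ((Fin (n + n) → AdeleRing (𝓞 F) F) × (Fin (n + n) → AdeleRing (𝓞 F) F)) ≃ₗ[AdeleRing (𝓞 F) F]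
            ((Fin (n + n) → AdeleRing (𝓞 F) F) × (Fin (n + n) → AdeleRing (𝓞 F) F))) v) ∧
      ∀ (Φ : piSchwartzBruhat F (Fin (n + n))) (C' : Set ↥(UnitaryGroup.adelic F E c (1 + 1)
          ((Matrix.reindex finSumFinEquiv finSumFinEquiv (Matrix.fromBlocks TW 0 0 (-TW))).map (algebraMap F E)))), IsCompact C' →
        ∃ Φ₀ : piSchwartzBruhat F (Fin (n + n)), ∀ A ∈ C', ∀ x,
          ‖((adelicMpCont.omega F (Fin (n + n)) (doubledGramFin F (adelicGram F e TV TW))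
                (u₀ * doublingDeltaLift F (adelicGram F e TV TW) (isUnit_det_adelicGram F e hVd hWd) * s A *
                  (u₀ * doublingDeltaLift F (adelicGram F e TV TW) (isUnit_det_adelicGram F e hVd hWd))⁻¹) Φ : piSchwartzBruhat F (Fin (n + n))) :
              (Fin (n + n) → AdeleRing (𝓞 F) F) → ℂ) x‖ ≤
            (((Φ₀ : piSchwartzBruhat F (Fin (n + n))) : (Fin (n + n) → AdeleRing (𝓞 F) F) → ℂ) x).re := by
  -- diagonalise `T_V` over `F`: `Pᵀ T_V P = diag c`, `Q = P⁻¹`, `T_V = Qᵀ diag(c) Q`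
  have hdg := Literature.NumberTheory.QuadraticForms.exists_congr_diagonal TV hV
  rcases hdg with ⟨P, Q, cV, hPQ, hQP, hdiag, hc0⟩
  have hcV : ∀ i, cV i ≠ 0 := hc0 hVd.ne_zero
  have hQ : IsUnit Q.det := Matrix.isUnit_det_of_left_inverse hPQ
  have hTV : Qᵀ * Matrix.diagonal cV * Q = TV := by rw [← hdiag]; exact Prop311.congr_congr_eq_of_mul_eq_one hPQ
  -- the doubled line `T_W ⊕ −T_W = 1ᵀ diag(t, −t) 1`, the doubled Gram identity, the signs at `M = 2`
  have htW : ∀ j : Fin (1 + 1), ![TW 0 0, -TW 0 0] j ≠ 0 := by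
    intro j
    fin_cases j
    · exact tW_ne_zero F TW hWd
    · exact neg_ne_zero.2 (tW_ne_zero F TW hWd)
  have hex := exists_implementerHom_of_congr F E c hcδ hδ hd N (1 + 1)
    (((Equiv.prodCongr (Equiv.refl (Fin N)) finSumFinEquiv.symm).trans (Equiv.prodSumDistrib (Fin N) (Fin 1) (Fin 1))).trans
      ((Equiv.sumCongr e e).trans finSumFinEquiv))
    cV ![TW 0 0, -TW 0 0] hcV htW (hrk_doubledLine F TW hWd) hQ hTV (one_transpose_mul_diagonal_mul_one_eq_doubledLine F TW) hV hW2
    (UnitaryGroup.adelicGram_doubled_eq_doubledGramFin F N e (TV := TV) (TW := TW)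
      (TW2 := Matrix.reindex finSumFinEquiv finSumFinEquiv (Matrix.fromBlocks TW 0 0 (-TW))) rfl)
  rcases hex with ⟨S, hS, hproj, hdom⟩
  exact ⟨S, continuous_subtype_val.comp hS, hproj, fun Φ C' hC' =>
    hdom (u₀ * doublingDeltaLift F (adelicGram F e TV TW) (isUnit_det_adelicGram F e hVd hWd)) Φ C' hC'⟩

include hV hVd hWd in
/-- **Per-`Φ` form** of `exists_implementerHom_CM` — the binder `himpl Φ` of ★ A6c′
`E2SWBorelBoundCMImpl.exists_borelBound_hBOUND_of_implementerHom` (F0P4-p07 (g3)) TOKEN FOR TOKEN: `∃ s, hs ∧ hproj ∧ hdom` at this `Φ`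
(the same `s` for every `Φ`). [cite: Weil1964, Chap. III n° 41, Lemme 5 p. 194] [cite: GelbartRogawski1991, §3.1 Prop. 3.1.1 p. 455 L1–3] -/
theorem exists_implementerHom_CM_of [IsTotallyReal F] [IsTotallyComplex E]
    (u₀ : adelicMpCont F (Fin (n + n)) (doubledGramFin F (adelicGram F e TV TW))) (Φ : piSchwartzBruhat F (Fin (n + n))) :
    ∃ s : ↥(UnitaryGroup.adelic F E c (1 + 1)
        ((Matrix.reindex finSumFinEquiv finSumFinEquiv (Matrix.fromBlocks TW 0 0 (-TW))).map (algebraMap F E))) →*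
      adelicMpCont F (Fin (n + n)) (doubledGramFin F (adelicGram F e TV TW)),
      (Continuous fun A => (s A : adelicMp F (Fin (n + n)) (doubledGramFin F (adelicGram F e TV TW)))) ∧
      (∀ (A : ↥(UnitaryGroup.adelic F E c (1 + 1)
          ((Matrix.reindex finSumFinEquiv finSumFinEquiv (Matrix.fromBlocks TW 0 0 (-TW))).map (algebraMap F E))))
          (v : (Fin (n + n) → AdeleRing (𝓞 F) F) × (Fin (n + n) → AdeleRing (𝓞 F) F)),
        ((adelicMpCont.proj F (Fin (n + n)) (doubledGramFin F (adelicGram F e TV TW)) (s A) :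
            symplecticGroup (polar (adelicForm F (Fin (n + n)) (doubledGramFin F (adelicGram F e TV TW))))) :
          ((Fin (n + n) → AdeleRing (𝓞 F) F) × (Fin (n + n) → AdeleRing (𝓞 F) F)) ≃ₗ[AdeleRing (𝓞 F) F]
            ((Fin (n + n) → AdeleRing (𝓞 F) F) × (Fin (n + n) → AdeleRing (𝓞 F) F))) v =
        ((toSp F E c N (1 + 1)
            (((Equiv.prodCongr (Equiv.refl (Fin N)) finSumFinEquiv.symm).trans (Equiv.prodSumDistrib (Fin N) (Fin 1) (Fin 1))).trans
              ((Equiv.sumCongr e e).trans finSumFinEquiv))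
            (TV.map (algebraMap F E)) ((Matrix.reindex finSumFinEquiv finSumFinEquiv (Matrix.fromBlocks TW 0 0 (-TW))).map (algebraMap F E))
            hcδ hδ hd hV hW2 rfl rfl
            (adelicInr F E c N (1 + 1) (TV.map (algebraMap F E))
              ((Matrix.reindex finSumFinEquiv finSumFinEquiv (Matrix.fromBlocks TW 0 0 (-TW))).map (algebraMap F E)) A) :
            symplecticGroup (polar (adelicForm F (Fin (n + n))
              (adelicGram F
                (((Equiv.prodCongr (Equiv.refl (Fin N)) finSumFinEquiv.symm).trans (Equiv.prodSumDistrib (Fin N) (Fin 1) (Fin 1))).trans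
                  ((Equiv.sumCongr e e).trans finSumFinEquiv)) TV
                (Matrix.reindex finSumFinEquiv finSumFinEquiv (Matrix.fromBlocks TW 0 0 (-TW))))))) :
          ((Fin (n + n) → AdeleRing (𝓞 F) F) × (Fin (n + n) → AdeleRing (𝓞 F) F)) ≃ₗ[AdeleRing (𝓞 F) F]
            ((Fin (n + n) → AdeleRing (𝓞 F) F) × (Fin (n + n) → AdeleRing (𝓞 F) F))) v) ∧
      (∀ C' : Set ↥(UnitaryGroup.adelic F E c (1 + 1)
          ((Matrix.reindex finSumFinEquiv finSumFinEquiv (Matrix.fromBlocks TW 0 0 (-TW))).map (algebraMap F E))), IsCompact C' →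
        ∃ Φ₀ : piSchwartzBruhat F (Fin (n + n)), ∀ A ∈ C', ∀ x,
          ‖((adelicMpCont.omega F (Fin (n + n)) (doubledGramFin F (adelicGram F e TV TW))
                (u₀ * doublingDeltaLift F (adelicGram F e TV TW) (isUnit_det_adelicGram F e hVd hWd) * s A *
                  (u₀ * doublingDeltaLift F (adelicGram F e TV TW) (isUnit_det_adelicGram F e hVd hWd))⁻¹) Φ : piSchwartzBruhat F (Fin (n + n))) :
              (Fin (n + n) → AdeleRing (𝓞 F) F) → ℂ) x‖ ≤
            (((Φ₀ : piSchwartzBruhat F (Fin (n + n))) : (Fin (n + n) → AdeleRing (𝓞 F) F) → ℂ) x).re) := by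
  have h := exists_implementerHom_CM F E c hcδ hδ hd N e TV TW hV hW2 hVd hWd u₀
  rcases h with ⟨s, hs, hproj, hdom⟩
  exact ⟨s, hs, hproj, fun C' hC' => hdom Φ C' hC'⟩

end CM


end Summit.HodgeConjecture.HodgeConjecture.Cruxes.H413.E2SWBorelBoundLettersCM

end
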